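import Literature.NumberTheory.GaloisRepresentations.AbsGaloisGroup
import Mathlib.RingTheory.RootsOfUnity.PrimitiveRoots
import Mathlib.Analysis.SpecialFunctions.Complex.Circle
import HarnessLib

/-!
# Roots of unity under complex conjugation and commutators; cube roots — elementary lemmas for
# the non-emptiness of the Chebotarev class of `stub_chebotarevSupplyAtThree` (crux 19109, line `inert`)

Crux `stmt-BirchSwinnertonDyer-19109` (`EulerHalvesAtThree`), line `inert` (tam3-p1 g18, skeleton r19),
registered stub `stub_chebotarevSupplyAtThree`; STUB-PLAN (evidence on the item), part NONEMPTY (C2):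
the Frobenius class is realised by `σ₀ = c₀ · ã^j · [x̃, ỹ]` acting on a cube root `c` of `γ₀`
(`c³ = γ₀`, `c₀` complex conjugation with `c₀ c = c⁻¹`, `ã c = ω c`, `[x̃, ỹ] c = ω^i c`).  This file
collects the ELEMENTARY algebra of that computation, for a group `G` acting on a field `L` by ring
automorphisms (`MulSemiringAction`), so that the number-theoretic files only plug in
`G = Γ_ℚ`, `L = ℚ̄`:

* `smul_eq_inv_of_pow_eq_one` — a complex conjugation of `Γ_ℚ` inverts every root of unity of `ℚ̄`;
* `exists_pow_eq_smul_of_isPrimitiveRoot`, `commutator_smul_eq_self_of_isPrimitiveRoot` — every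
  automorphism maps a primitive root of unity to a power of it, so commutators fix it;
* `eq_mul_pow_of_pow_three_eq` — `z³ = w³ ≠ 0 ⟹ z = ω^i w`, `i < 3`;
* `smul_eq_inv_of_involutive` — `c₀ c = c⁻¹` when `c³ = γ`, `c₀ γ = γ⁻¹`, `c₀² = 1` and `c₀` inverts
  the cube roots of unity;
* `pow_smul_eq_pow_mul` — `a c = ω c`, `a ω = ω ⟹ a^j c = ω^j c`;
* `smul_eq_self_of_commutator_smul_eq_self` — the commutator computation `[g, h] c = ω^{-2i} c`: if
  `g c = ω^m c⁻¹`, `h c = ω^i c`, both fix `ω`, and `[g, h]` fixes `c`, then `h` fixes `c`;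
* `sq_smul_eq_pow_mul` / `pow_mul_eq_self_iff` — `(c₀ a h)² c = ω^{2(j+i)} c`, `= c ↔ 3 ∣ j + i`;
* `inv_smul_eq_of_smul_eq_mul_inv`, `inv_smul_eq_of_smul_eq_mul`, `pow_smul_eq_self`,
  `smul_pow_eq_of_smul_eq` — inversion / power bookkeeping for such action equations.

Pure algebra; no elliptic curve, no number field beyond `ℚ̄` in the first lemma.  HONEST FRAMING: helper
lemmas toward one registered stub of one line of crux 19109; BSD is proved for no curve here.

## References

* J. Neukirch, *Algebraic Number Theory* (1999), Ch. IV §1 (infinite Galois theory: `Γ_ℚ` acting on `ℚ̄`). [NeukirchANT1999]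

## Mathlib / tree search

Tree: `GaloisRepresentations.IsComplexConjugation`, `isComplexConjugation_iff` (`AbsGaloisGroup`).
Mathlib: `IsPrimitiveRoot.eq_pow_of_pow_eq_one`, `IsPrimitiveRoot.pow_eq_one_iff_dvd`,
`Complex.inv_eq_conj`, `Complex.norm_eq_one_of_pow_eq_one`, `smul_inv''`, `smul_mul'`, `smul_pow`.
`lean search 'commutator.*IsPrimitiveRoot|IsComplexConjugation.*pow_eq_one'` (2026-08-28): nothing.
-/

set_option autoImplicit false
set_option linter.dupNamespace false

namespace Summit.BirchSwinnertonDyer.BirchSwinnertonDyer.Theorems.ChebSupply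

open Literature.NumberTheory.GaloisRepresentations Field

/-! ## §1 Complex conjugation inverts roots of unity -/

/-- **A complex conjugation of `Γ_ℚ` inverts every root of unity of `ℚ̄`**: if `ζ^n = 1`, `n ≠ 0`,
then `c₀ ζ = ζ⁻¹` (through a complex embedding `ι` with `ι(c₀ x) = conj (ι x)`, `|ι ζ| = 1`).
[cite: NeukirchANT1999, Ch. IV §1] -/
theorem smul_eq_inv_of_pow_eq_one {c₀ : absoluteGaloisGroup ℚ}
    (hc : IsComplexConjugation (Rat.castHom ℝ) c₀) {ζ : AlgebraicClosure ℚ} {n : ℕ} (hn : n ≠ 0)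
    (hζ : ζ ^ n = 1) : c₀ • ζ = ζ⁻¹ := by
  obtain ⟨ι, -, hι⟩ := isComplexConjugation_iff.mp hc
  apply ι.injective
  have hnorm : ‖ι ζ‖ = 1 := Complex.norm_eq_one_of_pow_eq_one (by rw [← map_pow, hζ, map_one]) hn
  rw [hι, map_inv₀, Complex.inv_eq_conj hnorm]

/-! ## §2 Automorphisms act on a primitive root of unity by powers; commutators fix it -/

section Action

variable {G L : Type*} [Group G] [Field L] [MulSemiringAction G L]

/-- An automorphism maps a primitive `n`-th root of unity `ζ` to a power of `ζ`. [folklore] -/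
theorem exists_pow_eq_smul_of_isPrimitiveRoot {ζ : L} {n : ℕ} (hζ : IsPrimitiveRoot ζ n) (hn : 0 < n)
    (g : G) : ∃ a : ℕ, g • ζ = ζ ^ a := by
  haveI : NeZero n := ⟨hn.ne'⟩
  have h1 : (g • ζ) ^ n = 1 := by rw [← smul_pow', hζ.pow_eq_one, smul_one]
  obtain ⟨a, -, ha⟩ := hζ.eq_pow_of_pow_eq_one h1
  exact ⟨a, ha.symm⟩

/-- **Commutators fix roots of unity**: `(x y x⁻¹ y⁻¹) ζ = ζ` for a primitive root of unity `ζ` (both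
`x`, `y` act on `ζ` by powers, which commute). [folklore] -/
theorem commutator_smul_eq_self_of_isPrimitiveRoot {ζ : L} {n : ℕ} (hζ : IsPrimitiveRoot ζ n)
    (hn : 0 < n) (x y : G) : (x * y * x⁻¹ * y⁻¹) • ζ = ζ := by
  obtain ⟨a, ha⟩ := exists_pow_eq_smul_of_isPrimitiveRoot hζ hn x⁻¹
  obtain ⟨b, hb⟩ := exists_pow_eq_smul_of_isPrimitiveRoot hζ hn y⁻¹
  have hxy : (x⁻¹ * y⁻¹) • ζ = (y⁻¹ * x⁻¹) • ζ := by
    rw [mul_smul, hb, smul_pow', ha, mul_smul, ha, smul_pow', hb, ← pow_mul, ← pow_mul, mul_comm]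
  have h : x * y * x⁻¹ * y⁻¹ = (y⁻¹ * x⁻¹)⁻¹ * (x⁻¹ * y⁻¹) := by group
  rw [h, mul_smul, hxy, ← mul_smul, inv_mul_cancel, one_smul]

/-- An element fixing `ζ` fixes its powers. [folklore] -/
theorem smul_pow_eq_of_smul_eq {ζ : L} {g : G} (h : g • ζ = ζ) (k : ℕ) : g • ζ ^ k = ζ ^ k := by
  rw [smul_pow', h]

/-- Powers of an element fixing `ω` fix `ω`. [folklore] -/
theorem pow_smul_eq_self {ω : L} {a : G} (haω : a • ω = ω) (j : ℕ) : (a ^ j) • ω = ω := by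
  induction j with
  | zero => rw [pow_zero, one_smul]
  | succ j ih => rw [pow_succ, mul_smul, haω, ih]

/-! ## §3 Cube roots -/

/-- **`z³ = w³ ≠ 0 ⟹ z = ω^i w` for some `i < 3`** (`ω` a primitive cube root of unity). [folklore] -/
theorem eq_mul_pow_of_pow_three_eq {ω z w : L} (hω : IsPrimitiveRoot ω 3) (hw : w ≠ 0)
    (h : z ^ 3 = w ^ 3) : ∃ i < 3, z = ω ^ i * w := by
  have h1 : (z / w) ^ 3 = 1 := by rw [div_pow, h, div_self (pow_ne_zero 3 hw)]
  obtain ⟨i, hi, hzi⟩ := hω.eq_pow_of_pow_eq_one h1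
  exact ⟨i, hi, by rw [hzi, div_mul_cancel₀ z hw]⟩

/-- **`c₀ c = c⁻¹`**: if `c³ = γ ≠ 0`, `c₀ γ = γ⁻¹`, `c₀` is an involution on `L` and inverts every cube
root of unity, then `c₀ c = c⁻¹` (the cube root of unity `u = c₀(c)·c` is fixed AND inverted by `c₀`).
[folklore] -/
theorem smul_eq_inv_of_involutive {c γ : L} {c₀ : G} (hγ : γ ≠ 0) (hc : c ^ 3 = γ)
    (hc₀γ : c₀ • γ = γ⁻¹) (hinv : ∀ x : L, c₀ • (c₀ • x) = x)
    (hroots : ∀ u : L, u ^ 3 = 1 → c₀ • u = u⁻¹) : c₀ • c = c⁻¹ := by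
  set u := (c₀ • c) * c with hu
  have hu3 : u ^ 3 = 1 := by
    rw [hu, mul_pow, ← smul_pow', hc, hc₀γ, inv_mul_cancel₀ hγ]
  have hu0 : u ≠ 0 := fun h0 => by rw [h0] at hu3; norm_num at hu3
  have hfix : c₀ • u = u := by
    rw [hu, smul_mul', hinv, mul_comm]
  have huinv : u = u⁻¹ := by rw [← hroots u hu3, hfix]
  have h2 : u * u = 1 := by
    nth_rewrite 2 [huinv]
    exact mul_inv_cancel₀ hu0
  have hu1 : u = 1 := by
    have h3 : u ^ 3 = u * (u * u) := by ring
    rw [h2, mul_one] at h3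
    rw [← h3, hu3]
  exact eq_inv_of_mul_eq_one_left (by rw [← hu]; exact hu1)

/-- **`a^j c = ω^j c`** when `a c = ω c` and `a ω = ω`. [folklore] -/
theorem pow_smul_eq_pow_mul {ω c : L} {a : G} (ha : a • c = ω * c) (haω : a • ω = ω) (j : ℕ) :
    (a ^ j) • c = ω ^ j * c := by
  induction j with
  | zero => rw [pow_zero, one_smul, pow_zero, one_mul]
  | succ j ih =>
    rw [pow_succ, mul_smul, ha, smul_mul', pow_smul_eq_self haω, ih, ← mul_assoc,
      mul_comm ω (ω ^ j), ← pow_succ]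

/-- Inverting an action equation: `g c = ω^m c⁻¹`, `g ω = ω ⟹ g⁻¹ c = ω^m c⁻¹`. [folklore] -/
theorem inv_smul_eq_of_smul_eq_mul_inv {ω c : L} (hc : c ≠ 0) {g : G} {m : ℕ}
    (hg : g • c = ω ^ m * c⁻¹) (hgω : g • ω = ω) : g⁻¹ • c = ω ^ m * c⁻¹ := by
  have hgω' : g⁻¹ • ω = ω := inv_smul_eq_iff.mpr hgω.symm
  have hne : g⁻¹ • c ≠ 0 := (smul_ne_zero_iff_ne g⁻¹).mpr hc
  have h1 : c = ω ^ m * (g⁻¹ • c)⁻¹ := by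
    conv_lhs => rw [← inv_smul_smul g c, hg]
    rw [smul_mul', smul_pow', hgω', smul_inv'']
  have h2 : (g⁻¹ • c) * c = ω ^ m := by
    have h3 : (g⁻¹ • c) * c = (g⁻¹ • c) * (ω ^ m * (g⁻¹ • c)⁻¹) := congrArg _ h1
    rw [h3, mul_comm (ω ^ m), ← mul_assoc, mul_inv_cancel₀ hne, one_mul]
  exact (eq_mul_inv_iff_mul_eq₀ hc).mpr h2

/-- Inverting an action equation: `h c = ω^i c`, `h ω = ω ⟹ h⁻¹ c = (ω^i)⁻¹ c`. [folklore] -/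
theorem inv_smul_eq_of_smul_eq_mul {ω c : L} {h : G} {i : ℕ}
    (hh : h • c = ω ^ i * c) (hhω : h • ω = ω) (hω : ω ≠ 0) : h⁻¹ • c = (ω ^ i)⁻¹ * c := by
  have hhω' : h⁻¹ • ω = ω := inv_smul_eq_iff.mpr hhω.symm
  have h1 : c = ω ^ i * (h⁻¹ • c) := by
    conv_lhs => rw [← inv_smul_smul h c, hh]
    rw [smul_mul', smul_pow', hhω']
  have h2 : (ω ^ i)⁻¹ * c = (ω ^ i)⁻¹ * (ω ^ i * (h⁻¹ • c)) := congrArg _ h1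
  rw [h2, ← mul_assoc, inv_mul_cancel₀ (pow_ne_zero i hω), one_mul]

/-- **The commutator computation**: `g c = ω^m c⁻¹`, `h c = ω^i c`, `g ω = ω = h ω`, and `[g, h] c = c`
force `h c = c` (indeed `[g, h] c = ω^{-2i} c`, so `3 ∣ i`). [folklore] -/
theorem smul_eq_self_of_commutator_smul_eq_self {ω c : L} (hω : IsPrimitiveRoot ω 3) (hc : c ≠ 0)
    {g h : G} {m i : ℕ} (hg : g • c = ω ^ m * c⁻¹) (hgω : g • ω = ω) (hh : h • c = ω ^ i * c)
    (hhω : h • ω = ω) (hcomm : (g * h * g⁻¹ * h⁻¹) • c = c) : h • c = c := by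
  have hω0 : ω ≠ 0 := hω.ne_zero (by norm_num)
  have hωi0 : ω ^ i ≠ 0 := pow_ne_zero i hω0
  have hωm0 : ω ^ m ≠ 0 := pow_ne_zero m hω0
  have hgω' : g⁻¹ • ω = ω := inv_smul_eq_iff.mpr hgω.symm
  have hginv := inv_smul_eq_of_smul_eq_mul_inv hc hg hgω
  have hhinv := inv_smul_eq_of_smul_eq_mul hh hhω hω0
  have e2 : g⁻¹ • (h⁻¹ • c) = (ω ^ i)⁻¹ * (ω ^ m * c⁻¹) := by
    rw [hhinv, smul_mul', smul_inv'', smul_pow', hgω', hginv]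
  have e3 : h • (g⁻¹ • (h⁻¹ • c)) = (ω ^ i)⁻¹ * (ω ^ m * (ω ^ i * c)⁻¹) := by
    rw [e2, smul_mul', smul_inv'', smul_pow', hhω, smul_mul', smul_pow', hhω, smul_inv'', hh]
  have e4 : g • (h • (g⁻¹ • (h⁻¹ • c))) = (ω ^ i)⁻¹ * (ω ^ m * (ω ^ i * (ω ^ m * c⁻¹))⁻¹) := by
    rw [e3, smul_mul', smul_inv'', smul_pow', hgω, smul_mul', smul_pow', hgω, smul_inv'', smul_mul',
      smul_pow', hgω, hg]
  have e5 : (ω ^ i)⁻¹ * (ω ^ m * (ω ^ i * (ω ^ m * c⁻¹))⁻¹) = (ω ^ i * ω ^ i)⁻¹ * c := by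
    field_simp
  rw [mul_smul, mul_smul, mul_smul, e4, e5, mul_left_eq_self₀, or_iff_left hc, inv_eq_one, ← pow_two,
    ← pow_mul] at hcomm
  -- `ω^{2i} = 1 ⟹ 3 ∣ i ⟹ ω^i = 1`
  have h3 : 3 ∣ i * 2 := (hω.pow_eq_one_iff_dvd _).mp hcomm
  have hi : 3 ∣ i := Nat.Coprime.dvd_of_dvd_mul_right (by norm_num) h3
  rw [hh, (hω.pow_eq_one_iff_dvd i).mpr hi, one_mul]

/-- **`(c₀ a h)² c = ω^{2(j+i)} c`**: `c₀ c = c⁻¹`, `c₀ ω = ω⁻¹`, `a c = ω^j c`, `h c = ω^i c`, `a`, `h`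
fix `ω`. [folklore] -/
theorem sq_smul_eq_pow_mul {ω c : L} {c₀ a h : G} (hc₀c : c₀ • c = c⁻¹)
    (hc₀ω : c₀ • ω = ω⁻¹) {j i : ℕ} (ha : a • c = ω ^ j * c) (haω : a • ω = ω)
    (hh : h • c = ω ^ i * c) (hhω : h • ω = ω) :
    (c₀ * a * h) • ((c₀ * a * h) • c) = ω ^ (2 * (j + i)) * c := by
  have h1 : (c₀ * a * h) • c = (ω ^ (j + i))⁻¹ * c⁻¹ := by
    rw [mul_smul, mul_smul, hh, smul_mul', smul_pow', haω, ha, smul_mul', smul_mul', smul_pow', hc₀ω,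
      smul_pow', hc₀ω, hc₀c, ← mul_assoc, ← pow_add, inv_pow, add_comm]
  have h2 : (c₀ * a * h) • ω = ω⁻¹ := by
    rw [mul_smul, mul_smul, hhω, haω, hc₀ω]
  rw [h1, smul_mul', smul_inv'', smul_inv'', smul_pow', h2, h1, inv_pow, inv_inv, mul_inv, inv_inv,
    inv_inv, ← mul_assoc, ← pow_add, two_mul]

/-- `ω^{2n} c = c ↔ 3 ∣ n` (`ω` a primitive cube root of unity, `c ≠ 0`). [folklore] -/
theorem pow_mul_eq_self_iff {ω c : L} (hω : IsPrimitiveRoot ω 3) (hc : c ≠ 0) (n : ℕ) :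
    ω ^ (2 * n) * c = c ↔ 3 ∣ n := by
  rw [mul_left_eq_self₀, or_iff_left hc, hω.pow_eq_one_iff_dvd]
  exact ⟨fun h => Nat.Coprime.dvd_of_dvd_mul_left (by norm_num) h, fun h => Dvd.dvd.mul_left h 2⟩

end Action

end Summit.BirchSwinnertonDyer.BirchSwinnertonDyer.Theorems.ChebSupply
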